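import Summits.CriticalPhenomena.PercolationContinuityZ3.Theorems.PercNearOneGluingNoHeavyQuantFlowArgmin
import HarnessLib

/-!
# QUANT lane R8, T-DEC: GIANT-MINIMAL FLOWS — a flow witness minimising the giant-routed low mass exists (`exists_isFlowAtT_giantMin`) and
# in it EVERY MID COMPATIBLE WITH A GIANT-ROUTED LOW IS SATURATED (`IsFlowAtT.mid_saturated_of_giantMin`): the normal form (n4) of typer g27

builds on p205010 (kernel theorem, internal audit signed; external expert review pending)

Support file (`--supports stmt-CriticalPhenomena-4575`), QUANT lane seat prim-quant-arm-1 (gen 39), rung R8 of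
`run/shared/lean/prim/quant/LADDER.md`.  Theorems only (no definitions), standard axioms, no sorries.  Uses `…QuantFlowArgmin` (this seat:
compactness of the flow polytope, minimisers exist) and typer g22/lead g21's exchange move `IsFlowAtT.shift` (`…QuantFlowUncross`).
WHY: the transfer route to `LawDec.TwinMoveDEC` (TWIN-MOVE-G39 §4–§5) certifies the income criterion from a GIANT-MINIMAL flow of `Λ`
(600/600 exact instances) but not from an arbitrary vertex flow (578/600); typer g27's roadmap for (M) general a needs the normal-form facts
(n1)–(n4) from an argmax over the flow polytope (GATE-MOVE-BLOB-G27 §3).  This file supplies the argmin and (n4).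

* `LawDec.exists_isFlowAtT_giantMin` — `FlowAtT ⟹` a flow witness minimising `G f = Σ_{l ≤ j′} Σ_{j′ < h ≤ M} f l h` among all witnesses.
* **`LawDec.IsFlowAtT.mid_saturated_of_giantMin`** — in such a witness, if a low `l` ships a positive mass to a giant `h₀`, then every mid
  `m ≤ min(j′, M)` compatible with `l` (`T ≤ 2m`, `T < l + m`) is saturated: `Σ_{l′} usage(l′,m)·f l′ m = μ m` (else shift `ε` from `h₀` to `m`).

[this work]; exchange move: this lane (`IsFlowAtT.shift`).  Nothing here is cited as a published result.  The gluing rows served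
[cite: KozmaNitzan2024, Conjecture 3 (p. 15)]; product measure [cite: Grimmett1999, §1.3 p. 10].
-/

noncomputable section

namespace Summit.CriticalPhenomena.PercolationContinuityZ3.Theorems

namespace Quant

open Finset

namespace LawDec

/-- **A GIANT-MINIMAL FLOW WITNESS EXISTS**: if `μ` has a flow at `(x, T, j′)` on `{0..M}`, some witness minimises the giant-routed low mass
`Σ_{l ≤ j′} Σ_{j′ < h ≤ M} f l h` (compactness, `exists_isFlowAtT_isMinOn`). [this work] -/
theorem exists_isFlowAtT_giantMin (x T : ℝ) (j' M : ℕ) (μ : ℕ → ℝ) (h : FlowAtT x T j' M μ) :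
    ∃ f, IsFlowAtT x T j' M μ f ∧ ∀ f', IsFlowAtT x T j' M μ f' →
      ∑ l ∈ Finset.range (j' + 1), ∑ h ∈ Finset.Ico (j' + 1) (M + 1), f l h
        ≤ ∑ l ∈ Finset.range (j' + 1), ∑ h ∈ Finset.Ico (j' + 1) (M + 1), f' l h := by
  have hc := continuous_flowFunctional (Finset.range (j' + 1)) (Finset.Ico (j' + 1) (M + 1)) (fun _ _ => (1 : ℝ))
  simp only [one_mul] at hc
  exact exists_isFlowAtT_isMinOn x T j' M μ _ hc h

/-- **IN A GIANT-MINIMAL FLOW EVERY MID COMPATIBLE WITH A GIANT-ROUTED LOW IS SATURATED** (normal form (n4)).  `0 < x < 1`; `f` a flow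
witness of `μ` at `(x, T, j′, M)` minimising the giant-routed mass; a low `l` with `f l h₀ > 0` for a giant `h₀ ≥ j′+1`; a mid `m ≤ j′`, `m ≤ M`,
`T ≤ 2m`, compatible with `l` (`T < l + m`).  Then `Σ_{l′ ≤ j′} usage(l′, m)·f l′ m = μ m`.  Otherwise shifting `ε = min(f l h₀, slack/usage(l,m))`
of `l`'s mass from `h₀` to `m` (`IsFlowAtT.shift`) is a witness with smaller giant-routed mass. [this work] -/
theorem IsFlowAtT.mid_saturated_of_giantMin {x T : ℝ} {j' M : ℕ} {μ : ℕ → ℝ} {f : ℕ → ℕ → ℝ} (hF : IsFlowAtT x T j' M μ f)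
    (hx0 : 0 < x) (hx1 : x < 1)
    (hmin : ∀ f', IsFlowAtT x T j' M μ f' →
      ∑ l ∈ Finset.range (j' + 1), ∑ h ∈ Finset.Ico (j' + 1) (M + 1), f l h
        ≤ ∑ l ∈ Finset.range (j' + 1), ∑ h ∈ Finset.Ico (j' + 1) (M + 1), f' l h)
    (l h₀ m : ℕ) (hh₀ : j' + 1 ≤ h₀) (hfl : 0 < f l h₀) (hmj : m ≤ j') (hmM : m ≤ M) (hmid : T ≤ 2 * (m : ℝ))
    (hcomp : T < (l : ℝ) + m) :
    ∑ l' ∈ Finset.range (j' + 1), usage x T j' l' m * f l' m = μ m := by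
  classical
  obtain ⟨hf0, hsupp, hrow, hcol⟩ := id hF
  obtain ⟨hlj, hlow, hh₀M, _⟩ := hsupp l h₀ hfl
  have hload := hcol m hmM (Or.inr hmid)
  by_contra hne
  have hslack : 0 < μ m - ∑ l' ∈ Finset.range (j' + 1), usage x T j' l' m * f l' m := by
    rcases (lt_or_eq_of_le hload) with hlt | heq
    · linarith
    · exact absurd heq hne
  have hlm : l < m := by
    have : (l : ℝ) < m := by linarith
    exact_mod_cast this
  have hu : 0 < usage x T j' l m := usage_pos_of_compat x T j' l m hx0 hx1 hlow hlm (Or.inr hcomp)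
  set s : ℝ := μ m - ∑ l' ∈ Finset.range (j' + 1), usage x T j' l' m * f l' m with hs
  set ε : ℝ := min (f l h₀) (s / usage x T j' l m) with hε
  have hε0 : 0 < ε := lt_min hfl (div_pos hslack hu)
  have hεf : ε ≤ f l h₀ := min_le_left _ _
  have hεs : ε * usage x T j' l m ≤ s := by
    have : ε ≤ s / usage x T j' l m := min_le_right _ _
    rwa [le_div_iff₀ hu] at this
  have hmh : m ≠ h₀ := by omega
  -- the shifted witness
  have hF' := hF.shift hx0 hx1 l m h₀ hmh hlj hlow hmM (Or.inr hcomp) ε hε0.le hεf (by rw [hs] at hεs; linarith)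
  have hG := hmin _ hF'
  -- its giant-routed mass is smaller by `ε`
  have hsum : ∑ l' ∈ Finset.range (j' + 1), ∑ h ∈ Finset.Ico (j' + 1) (M + 1),
      (f l' h + ε * (if l' = l then (1:ℝ) else 0) * (if h = m then (1:ℝ) else 0)
        - ε * (if l' = l then (1:ℝ) else 0) * (if h = h₀ then (1:ℝ) else 0))
      = ∑ l' ∈ Finset.range (j' + 1), ∑ h ∈ Finset.Ico (j' + 1) (M + 1), f l' h - ε := by
    have hm_out : m ∉ Finset.Ico (j' + 1) (M + 1) := by rw [Finset.mem_Ico]; omega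
    have hh₀_in : h₀ ∈ Finset.Ico (j' + 1) (M + 1) := by rw [Finset.mem_Ico]; omega
    have hl_in : l ∈ Finset.range (j' + 1) := Finset.mem_range.2 (by omega)
    have inner : ∀ l' ∈ Finset.range (j' + 1), ∑ h ∈ Finset.Ico (j' + 1) (M + 1),
        (f l' h + ε * (if l' = l then (1:ℝ) else 0) * (if h = m then (1:ℝ) else 0)
          - ε * (if l' = l then (1:ℝ) else 0) * (if h = h₀ then (1:ℝ) else 0))
        = ∑ h ∈ Finset.Ico (j' + 1) (M + 1), f l' h - ε * (if l' = l then (1:ℝ) else 0) := by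
      intro l' _
      rw [Finset.sum_sub_distrib, Finset.sum_add_distrib]
      have e1 : ∑ h ∈ Finset.Ico (j' + 1) (M + 1), ε * (if l' = l then (1:ℝ) else 0) * (if h = m then (1:ℝ) else 0) = 0 :=
        Finset.sum_eq_zero fun h hh => by
          have hne : h ≠ m := fun he => hm_out (he ▸ hh)
          rw [if_neg hne]; ring
      have e2 : ∑ h ∈ Finset.Ico (j' + 1) (M + 1), ε * (if l' = l then (1:ℝ) else 0) * (if h = h₀ then (1:ℝ) else 0)
          = ε * (if l' = l then (1:ℝ) else 0) := by
        rw [Finset.sum_eq_single h₀ (fun h _ hne => by rw [if_neg hne, mul_zero]) (fun hn => absurd hh₀_in hn), if_pos rfl, mul_one]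
      rw [e1, e2]; ring
    rw [Finset.sum_congr rfl inner, Finset.sum_sub_distrib, ← Finset.mul_sum,
      Finset.sum_ite_eq' (Finset.range (j' + 1)) l, if_pos hl_in, mul_one]
  rw [hsum] at hG
  linarith

end LawDec

end Quant

end Summit.CriticalPhenomena.PercolationContinuityZ3.Theorems
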